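import Summits.NavierStokesRegularity.FunctionalMining.NonlinearPoincareHolderMap
import Summits.NavierStokesRegularity.FunctionalMining.VelocityL4SaturatingLaw
import Summits.NavierStokesRegularity.FunctionalMining.VorticityL4Pointwise
import Literature.Analysis.FunctionSpaces.TorusDiffMonomialBounds
import HarnessLib

/-!
# FunctionalMining — the static production bound for `U_s = ∫|u|^s`, real `4 < s < 6`, on `T³`

Search for candidate a priori estimates; no regularity claim. Cell `pub-nsfunc`, prove seat
(gen 10). The static half of the K0 rows `EV.s|T_LD|G1` at a REAL exponent (SIEVELD §3.5; the row
`s = 9/2` is the one not yet in the kernel, `s = 4, 6` being `VelocityL4/L6SaturatingLaw`). With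
`U = ∫‖u‖^s`, `Z = ‖∇u‖₂² = ∫g` (`g = ∑ₖ‖∂ₖu‖²`), `I = ∫‖u‖^{s−2}g`, `X = ∫(|u|²)^{s/2−1}⟪u, ∇p⟫`,
`σ = s − 3`, `e = (2s−3)/(3s−6) = γ/(1+γ)`, `γ = (2s−3)/(s−3)`:

1. `|X| ≤ ∫‖u‖^{s−1}‖∇p‖ ≤ (∫‖u‖^{2s−2})^{1/2}‖∇p‖₂` (Cauchy–Schwarz);
2. `‖∇p‖₂ ≤ C_p‖(u·∇)u‖₂ ≤ C_p (∫‖u‖²g)^{1/2}` (tree `Torus.exists_gradPressure_Ls_le_convect`,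
   Robinson–Rodrigo–Sadowski Thm B.7/(5.3));
3. `∫‖u‖²g ≤ I^{2/(s−2)} Z^{(s−4)/(s−2)}` (Hölder; `s > 4`);
4. `∫‖u‖^{2s−2} ≤ U^{2/3}(∫‖u‖^{4s−6})^{1/3}` and `∫‖u‖^{4s−6} ≤ (∫‖u‖⁶)^w(∫‖u‖^{3s})^{1−w}`,
   `w = (6−s)/(3s−6)` (Hölder; `s < 6`);
5. `∫‖u‖⁶ ≤ C₆Z³` (mean-zero Sobolev) and `∫‖u‖^{3s} ≤ C_T I³` (top node
   `NonlinearPoincare.integral_norm_rpow_top_le` at `a = (s−2)/2`);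
6. bookkeeping: `|X| ≤ C_p C₆^{w/6} C_T^{(1−w)/6} · I^e · (Z U^{1+1/σ})^{1−e}`
   (`w + (s−4)/(s−2) = 2(1−e)`, `(1−w) + 2/(s−2) = 2e`, `(1+1/σ)(1−e) = 1/3`) — the chain of
   SIEVELD §3.5 (`s = 9/2`: `‖u‖₇^{7/2} ≤ ‖u‖₆^{1/5}‖u‖_{27/2}^{9/5}‖u‖_{9/2}^{3/2}`,
   `‖|u|∇u‖₂ ≤ ‖|u|^{5/4}∇u‖₂^{4/5}‖∇u‖₂^{1/5}`) in Hölder form for every `4 < s < 6`.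
-/

noncomputable section

open MeasureTheory Finset Set Filter Topology
open scoped InnerProductSpace RealInnerProductSpace ContDiff

namespace Summit.NavierStokesRegularity.FunctionalMining

open Literature.Analysis.FunctionSpaces Literature.Analysis.FunctionSpaces.Torus
  Literature.Analysis.FluidPDE

namespace VelocityMoment

open VelocityL4 NonlinearPoincare

variable {d : Type*} [Fintype d] [DecidableEq d]

/-! ## 1. Pointwise, Cauchy–Schwarz, pressure -/

omit [Fintype d] [DecidableEq d] in
/-- `(‖v‖²)^r = ‖v‖^{2r}`. [folklore] -/
theorem normSq_rpow_eq {F : Type*} [NormedAddCommGroup F] (v : UnitAddTorus d → F)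
    (x : UnitAddTorus d) (r : ℝ) : (‖v x‖ ^ 2) ^ r = ‖v x‖ ^ (2 * r) := by
  rw [← Real.rpow_natCast, ← Real.rpow_mul (norm_nonneg _)]
  norm_num

omit [Fintype d] [DecidableEq d] in
/-- Continuity of `x ↦ ‖v x‖^r` for continuous `v`, `r ≥ 0`. [folklore] -/
theorem continuous_norm_rpow' {F : Type*} [NormedAddCommGroup F] {v : UnitAddTorus d → F}
    (hv : Continuous v) {r : ℝ} (hr : 0 ≤ r) : Continuous fun x => ‖v x‖ ^ r :=
  hv.norm.rpow_const fun _ => Or.inr hr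

omit [DecidableEq d] in
/-- **`|X| ≤ ∫ ‖u‖^{s−1}‖∇p‖`** for `X = ∫ (|u|²)^{s/2−1}⟪u, ∇p⟫`, real `s ≥ 2`. [ours] -/
theorem abs_pressure_production_le {u : UnitAddTorus d → EuclideanSpace ℝ d} (hu : IsSmooth u)
    {p : UnitAddTorus d → ℝ} (hp : IsSmooth p) {s : ℝ} (hs : 2 ≤ s) :
    |∫ x, (‖u x‖ ^ 2) ^ (s / 2 - 1) * ⟪u x, gradient p x⟫| ≤
      ∫ x, ‖u x‖ ^ (s - 1) * ‖gradient p x‖ := by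
  have hpt : ∀ x, |(‖u x‖ ^ 2) ^ (s / 2 - 1) * ⟪u x, gradient p x⟫| ≤
      ‖u x‖ ^ (s - 1) * ‖gradient p x‖ := by
    intro x
    have hn : 0 ≤ ‖u x‖ := norm_nonneg _
    rw [abs_mul, abs_of_nonneg (Real.rpow_nonneg (sq_nonneg _) _), normSq_rpow_eq]
    have e2 : ‖u x‖ ^ (2 * (s / 2 - 1)) * ‖u x‖ = ‖u x‖ ^ (s - 1) := by
      rcases eq_or_lt_of_le hn with hz | hpos
      · rw [← hz, mul_zero, Real.zero_rpow (by linarith)]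
      · rw [show s - 1 = 2 * (s / 2 - 1) + 1 by ring, Real.rpow_add hpos, Real.rpow_one]
    calc ‖u x‖ ^ (2 * (s / 2 - 1)) * |⟪u x, gradient p x⟫|
        ≤ ‖u x‖ ^ (2 * (s / 2 - 1)) * (‖u x‖ * ‖gradient p x‖) :=
          mul_le_mul_of_nonneg_left (abs_real_inner_le_norm _ _) (Real.rpow_nonneg hn _)
      _ = ‖u x‖ ^ (s - 1) * ‖gradient p x‖ := by rw [← mul_assoc, e2]
  have hc : Continuous fun x => ‖u x‖ ^ (s - 1) * ‖gradient p x‖ :=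
    (continuous_norm_rpow' hu.continuous (by linarith)).mul hp.gradient.continuous.norm
  calc |∫ x, (‖u x‖ ^ 2) ^ (s / 2 - 1) * ⟪u x, gradient p x⟫|
      ≤ ∫ x, |(‖u x‖ ^ 2) ^ (s / 2 - 1) * ⟪u x, gradient p x⟫| := abs_integral_le_integral_abs
    _ ≤ ∫ x, ‖u x‖ ^ (s - 1) * ‖gradient p x‖ :=
        integral_mono_of_nonneg (ae_of_all _ fun x => abs_nonneg _) hc.integrable_unitAddTorus
          (ae_of_all _ hpt)

omit [DecidableEq d] in
/-- **Cauchy–Schwarz**: `(∫‖u‖^{s−1}‖∇p‖)² ≤ (∫‖u‖^{2s−2})(∫‖∇p‖²)`, `s ≥ 1`. [folklore] -/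
theorem sq_integral_production_le {u : UnitAddTorus d → EuclideanSpace ℝ d} (hu : IsSmooth u)
    {p : UnitAddTorus d → ℝ} (hp : IsSmooth p) {s : ℝ} (hs : 1 ≤ s) :
    (∫ x, ‖u x‖ ^ (s - 1) * ‖gradient p x‖) ^ 2 ≤
      (∫ x, ‖u x‖ ^ (2 * s - 2)) * ∫ x, ‖gradient p x‖ ^ 2 := by
  have h := sq_integral_mul_le (f := fun x => ‖u x‖ ^ (s - 1)) (g := fun x => ‖gradient p x‖)
    (continuous_norm_rpow' hu.continuous (by linarith)) hp.gradient.continuous.norm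
  have e : ∀ x, (‖u x‖ ^ (s - 1)) ^ 2 = ‖u x‖ ^ (2 * s - 2) := fun x => by
    rw [← Real.rpow_natCast, ← Real.rpow_mul (norm_nonneg _)]; congr 1; push_cast; ring
  simp only [e] at h
  exact h

/-- **Pressure gradient in `L²` along a solution, squared form**: from the tree's
`(∫‖∇p‖²)^{1/2} ≤ C_p(∫‖(u·∇)u‖²)^{1/2}` and `‖(u·∇)u‖² ≤ ‖u‖²∑ₖ‖∂ₖu‖²`:
`∫‖∇p‖² ≤ C_p² ∫‖u‖²∑ₖ‖∂ₖu‖²`. [cite: RobinsonRodrigoSadowski2016, Thm B.7 and Ch. 5 (5.3)] -/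
theorem integral_gradPressure_sq_le {Cp : ℝ}
    {u : UnitAddTorus d → EuclideanSpace ℝ d} (hu : IsSmooth u) {p : UnitAddTorus d → ℝ}
    (h : (∫ x, ‖gradient p x‖ ^ (2 : ℝ)) ^ (1 / (2 : ℝ)) ≤
      Cp * (∫ x, ‖convect u u x‖ ^ (2 : ℝ)) ^ (1 / (2 : ℝ))) :
    ∫ x, ‖gradient p x‖ ^ 2 ≤ Cp ^ 2 * ∫ x, ‖u x‖ ^ 2 * ∑ k, ‖partialDeriv k u x‖ ^ 2 := by
  have h1 := sqrt_integral_sq_le_of_rpow (f := fun x => ‖gradient p x‖)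
    (g := fun x => ‖convect u u x‖) h
  have hP0 : 0 ≤ ∫ x, ‖gradient p x‖ ^ 2 := integral_nonneg fun x => sq_nonneg _
  have hC0 : 0 ≤ ∫ x, ‖convect u u x‖ ^ 2 := integral_nonneg fun x => sq_nonneg _
  have h2 : ∫ x, ‖gradient p x‖ ^ 2 ≤ Cp ^ 2 * ∫ x, ‖convect u u x‖ ^ 2 := by
    have h3 := pow_le_pow_left₀ (Real.sqrt_nonneg _) h1 2
    rw [Real.sq_sqrt hP0, mul_pow, Real.sq_sqrt hC0] at h3
    exact h3
  have h4 : ∫ x, ‖convect u u x‖ ^ 2 ≤ ∫ x, ‖u x‖ ^ 2 * ∑ k, ‖partialDeriv k u x‖ ^ 2 :=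
    integral_mono_of_nonneg (ae_of_all _ fun x => sq_nonneg _)
      ((hu.continuous.norm.pow 2).mul (VorticityL4.continuous_gradSq hu)).integrable_unitAddTorus
      (ae_of_all _ fun x => norm_convect_self_sq_le hu x)
  exact h2.trans (mul_le_mul_of_nonneg_left h4 (sq_nonneg _))

/-! ## 2. Three Hölder steps -/

/-- **`∫‖u‖²g ≤ (∫‖u‖^{s−2}g)^{2/(s−2)} (∫g)^{1−2/(s−2)}`**, `g = ∑ₖ‖∂ₖu‖²`, real `s > 4` (Hölder
with the convex weights `2/(s−2)`, `(s−4)/(s−2)`). [folklore] -/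
theorem integral_normSq_mul_gradSq_le {u : UnitAddTorus d → EuclideanSpace ℝ d} (hu : IsSmooth u)
    {s : ℝ} (hs : 4 < s) :
    ∫ x, ‖u x‖ ^ 2 * ∑ k, ‖partialDeriv k u x‖ ^ 2 ≤
      (∫ x, ‖u x‖ ^ (s - 2) * ∑ k, ‖partialDeriv k u x‖ ^ 2) ^ (2 / (s - 2)) *
        (∫ x, ∑ k, ‖partialDeriv k u x‖ ^ 2) ^ (1 - 2 / (s - 2)) := by
  obtain ⟨θ, hθ⟩ : ∃ θ : ℝ, θ = 2 / (s - 2) := ⟨_, rfl⟩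
  have hs2 : 0 < s - 2 := by linarith
  have hθ0 : 0 < θ := by rw [hθ]; exact div_pos two_pos hs2
  have hθ1 : θ < 1 := by rw [hθ, div_lt_one hs2]; linarith
  have hθ1' : 0 < 1 - θ := by linarith
  have hgc := VorticityL4.continuous_gradSq hu
  have hg0 : ∀ x, 0 ≤ ∑ k, ‖partialDeriv k u x‖ ^ 2 := fun x =>
    Finset.sum_nonneg fun k _ => sq_nonneg _
  have hn0 : ∀ x, 0 ≤ ‖u x‖ ^ (s - 2) * ∑ k, ‖partialDeriv k u x‖ ^ 2 := fun x =>
    mul_nonneg (Real.rpow_nonneg (norm_nonneg _) _) (hg0 x)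
  rw [← hθ]
  have h := integral_mul_le_rpow_mul_rpow
    (f := fun x => (‖u x‖ ^ (s - 2) * ∑ k, ‖partialDeriv k u x‖ ^ 2) ^ θ)
    (g := fun x => (∑ k, ‖partialDeriv k u x‖ ^ 2) ^ (1 - θ))
    (((continuous_norm_rpow' hu.continuous hs2.le).mul hgc).rpow_const fun x => Or.inr hθ0.le)
    (hgc.rpow_const fun x => Or.inr hθ1'.le)
    (fun x => Real.rpow_nonneg (hn0 x) _) (fun x => Real.rpow_nonneg (hg0 x) _) hθ0 hθ1' (by ring)
  have hθs : (s - 2) * θ = 2 := by rw [hθ]; field_simp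
  have e1 : ∀ x, (‖u x‖ ^ (s - 2) * ∑ k, ‖partialDeriv k u x‖ ^ 2) ^ θ *
      (∑ k, ‖partialDeriv k u x‖ ^ 2) ^ (1 - θ) = ‖u x‖ ^ 2 * ∑ k, ‖partialDeriv k u x‖ ^ 2 := by
    intro x
    rw [Real.mul_rpow (Real.rpow_nonneg (norm_nonneg _) _) (hg0 x), ← Real.rpow_mul (norm_nonneg _),
      hθs, Real.rpow_two, mul_assoc, ← Real.rpow_add' (hg0 x) (by linarith), add_sub_cancel,
      Real.rpow_one]
  have e2 : ∀ x, ((‖u x‖ ^ (s - 2) * ∑ k, ‖partialDeriv k u x‖ ^ 2) ^ θ) ^ θ⁻¹ =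
      ‖u x‖ ^ (s - 2) * ∑ k, ‖partialDeriv k u x‖ ^ 2 := fun x => by
    rw [← Real.rpow_mul (hn0 x), mul_inv_cancel₀ hθ0.ne', Real.rpow_one]
  have e3 : ∀ x, ((∑ k, ‖partialDeriv k u x‖ ^ 2) ^ (1 - θ)) ^ (1 - θ)⁻¹ =
      ∑ k, ‖partialDeriv k u x‖ ^ 2 := fun x => by
    rw [← Real.rpow_mul (hg0 x), mul_inv_cancel₀ hθ1'.ne', Real.rpow_one]
  simp only [e1, e2, e3] at h
  exact h

omit [DecidableEq d] in
/-- **`∫‖w‖^{2s−2} ≤ (∫‖w‖^s)^{2/3} (∫‖w‖^{4s−6})^{1/3}`** for continuous `w` and real `s ≥ 3/2`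
(Hölder, `‖w‖^{2s−2} = ‖w‖^{2s/3}·‖w‖^{(4s−6)/3}`). [folklore] -/
theorem integral_norm_rpow_two_s_le {F : Type*} [NormedAddCommGroup F] {w : UnitAddTorus d → F}
    (hw : Continuous w) {s : ℝ} (hs : 3 / 2 < s) :
    ∫ x, ‖w x‖ ^ (2 * s - 2) ≤
      (∫ x, ‖w x‖ ^ s) ^ (2 / 3 : ℝ) * (∫ x, ‖w x‖ ^ (4 * s - 6)) ^ (1 / 3 : ℝ) := by
  have h := integral_mul_le_rpow_mul_rpow
    (f := fun x => ‖w x‖ ^ (2 * s / 3)) (g := fun x => ‖w x‖ ^ ((4 * s - 6) / 3))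
    (continuous_norm_rpow' hw (by linarith)) (continuous_norm_rpow' hw (by linarith))
    (fun x => Real.rpow_nonneg (norm_nonneg _) _) (fun x => Real.rpow_nonneg (norm_nonneg _) _)
    (by norm_num : (0 : ℝ) < 2 / 3) (by norm_num : (0 : ℝ) < 1 / 3) (by norm_num)
  have e1 : ∀ x, ‖w x‖ ^ (2 * s / 3) * ‖w x‖ ^ ((4 * s - 6) / 3) = ‖w x‖ ^ (2 * s - 2) := fun x => by
    rw [← Real.rpow_add' (norm_nonneg _) (by linarith : 2 * s / 3 + (4 * s - 6) / 3 ≠ 0)]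
    congr 1; ring
  have e2 : ∀ x, (‖w x‖ ^ (2 * s / 3)) ^ (2 / 3 : ℝ)⁻¹ = ‖w x‖ ^ s := fun x => by
    rw [← Real.rpow_mul (norm_nonneg _)]; congr 1; field_simp
  have e3 : ∀ x, (‖w x‖ ^ ((4 * s - 6) / 3)) ^ (1 / 3 : ℝ)⁻¹ = ‖w x‖ ^ (4 * s - 6) := fun x => by
    rw [← Real.rpow_mul (norm_nonneg _)]; congr 1; field_simp
  simp only [e1, e2, e3] at h
  exact h

omit [DecidableEq d] in
/-- **`∫‖w‖^{4s−6} ≤ (∫‖w‖⁶)^w (∫‖w‖^{3s})^{1−w}`, `w = (6−s)/(3s−6)`**, for continuous `w` and real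
`3 < s < 6` (Hölder: `6w + 3s(1−w) = 4s − 6`). [folklore] -/
theorem integral_norm_rpow_four_s_le {F : Type*} [NormedAddCommGroup F] {w : UnitAddTorus d → F}
    (hw : Continuous w) {s : ℝ} (hs3 : 3 < s) (hs6 : s < 6) :
    ∫ x, ‖w x‖ ^ (4 * s - 6) ≤
      (∫ x, ‖w x‖ ^ (6 : ℝ)) ^ ((6 - s) / (3 * s - 6)) *
        (∫ x, ‖w x‖ ^ (3 * s)) ^ (1 - (6 - s) / (3 * s - 6)) := by
  obtain ⟨w₀, hw₀⟩ : ∃ w₀ : ℝ, w₀ = (6 - s) / (3 * s - 6) := ⟨_, rfl⟩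
  have h36 : 0 < 3 * s - 6 := by linarith
  have hw₀0 : 0 < w₀ := by rw [hw₀]; exact div_pos (by linarith) h36
  have hw₀1 : w₀ < 1 := by rw [hw₀, div_lt_one h36]; linarith
  have hw₀1' : 0 < 1 - w₀ := by linarith
  rw [← hw₀]
  have h := integral_mul_le_rpow_mul_rpow
    (f := fun x => ‖w x‖ ^ (6 * w₀)) (g := fun x => ‖w x‖ ^ (3 * s * (1 - w₀)))
    (continuous_norm_rpow' hw (by positivity)) (continuous_norm_rpow' hw (by positivity))
    (fun x => Real.rpow_nonneg (norm_nonneg _) _) (fun x => Real.rpow_nonneg (norm_nonneg _) _)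
    hw₀0 hw₀1' (by ring)
  have hw₀s : w₀ * (3 * s - 6) = 6 - s := by rw [hw₀, div_mul_cancel₀ _ h36.ne']
  have hexp : 6 * w₀ + 3 * s * (1 - w₀) = 4 * s - 6 := by linear_combination (-1 : ℝ) * hw₀s
  have e1 : ∀ x, ‖w x‖ ^ (6 * w₀) * ‖w x‖ ^ (3 * s * (1 - w₀)) = ‖w x‖ ^ (4 * s - 6) := fun x => by
    rw [← Real.rpow_add' (norm_nonneg _) (by rw [hexp]; linarith), hexp]
  have e2 : ∀ x, (‖w x‖ ^ (6 * w₀)) ^ w₀⁻¹ = ‖w x‖ ^ (6 : ℝ) := fun x => by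
    rw [← Real.rpow_mul (norm_nonneg _)]; congr 1; field_simp
  have e3 : ∀ x, (‖w x‖ ^ (3 * s * (1 - w₀))) ^ (1 - w₀)⁻¹ = ‖w x‖ ^ (3 * s) := fun x => by
    rw [← Real.rpow_mul (norm_nonneg _)]; congr 1; field_simp
  simp only [e1, e2, e3] at h
  exact h

/-! ## 3. Exponent bookkeeping -/

/-- **Exponent bookkeeping of SIEVELD §3.5 at a real `4 < s < 6`.** For non-negative reals with
`X² ≤ A P`, `P ≤ C_p² J`, `J ≤ I^{2/(s−2)} Z^{1−2/(s−2)}`, `A ≤ U^{2/3} B^{1/3}`,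
`B ≤ S₆^w T^{1−w}` (`w = (6−s)/(3s−6)`), `S₆ ≤ C₆ Z³`, `T ≤ C_T I³`:
`|X| ≤ C_p C₆^{w/6} C_T^{(1−w)/6} I^e (Z U^{1+1/(s−3)})^{1−e}`, `e = (2s−3)/(3s−6)`. [ours; elementary] -/
theorem production_rpow_bookkeeping {s X A P J I Z U B S₆ T Cp C₆ CT : ℝ} (hs4 : 4 < s)
    (hs6 : s < 6) (hP : 0 ≤ P) (hJ : 0 ≤ J) (hI : 0 ≤ I) (hZ : 0 ≤ Z) (hU : 0 ≤ U)
    (hB : 0 ≤ B) (hS : 0 ≤ S₆) (hT : 0 ≤ T) (hCp : 0 ≤ Cp) (hC₆ : 0 ≤ C₆) (hCT : 0 ≤ CT)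
    (h1 : X ^ 2 ≤ A * P) (h2 : P ≤ Cp ^ 2 * J)
    (h3 : J ≤ I ^ (2 / (s - 2)) * Z ^ (1 - 2 / (s - 2)))
    (h4 : A ≤ U ^ (2 / 3 : ℝ) * B ^ (1 / 3 : ℝ))
    (h5 : B ≤ S₆ ^ ((6 - s) / (3 * s - 6)) * T ^ (1 - (6 - s) / (3 * s - 6)))
    (h6 : S₆ ≤ C₆ * Z ^ 3) (h7 : T ≤ CT * I ^ 3) :
    |X| ≤ Cp * C₆ ^ ((6 - s) / (3 * s - 6) / 6) * CT ^ ((1 - (6 - s) / (3 * s - 6)) / 6) *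
      I ^ ((2 * s - 3) / (3 * s - 6)) *
        (Z * U ^ (1 + (s - 3)⁻¹)) ^ (1 - (2 * s - 3) / (3 * s - 6)) := by
  -- nonvanishing denominators (both syntactic forms, for `field_simp`)
  have hs2 : s - 2 ≠ 0 := by intro h; linarith
  have h36 : 3 * s - 6 ≠ 0 := by intro h; linarith
  have h36' : s * 3 - 6 ≠ 0 := by intro h; linarith
  have hs3 : s - 3 ≠ 0 := by intro h; linarith
  -- the exponents
  obtain ⟨θ, hθ⟩ : ∃ θ : ℝ, θ = 2 / (s - 2) := ⟨_, rfl⟩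
  obtain ⟨w₀, hw₀⟩ : ∃ w₀ : ℝ, w₀ = (6 - s) / (3 * s - 6) := ⟨_, rfl⟩
  obtain ⟨e, he⟩ : ∃ e : ℝ, e = (2 * s - 3) / (3 * s - 6) := ⟨_, rfl⟩
  rw [← hθ] at h3
  rw [← hw₀] at h5 ⊢
  rw [← he]
  have hθ0 : 0 < θ := by rw [hθ]; exact div_pos two_pos (by linarith)
  have hθ1 : θ < 1 := by rw [hθ, div_lt_one (by linarith)]; linarith
  have hw₀0 : 0 < w₀ := by rw [hw₀]; exact div_pos (by linarith) (by linarith)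
  have hw₀1 : w₀ < 1 := by rw [hw₀, div_lt_one (by linarith)]; linarith
  have he0 : 0 < e := by rw [he]; exact div_pos (by linarith) (by linarith)
  have he1 : e < 1 := by rw [he, div_lt_one (by linarith)]; linarith
  -- the three identities
  have i1 : w₀ + (1 - θ) = 2 * (1 - e) := by rw [hw₀, hθ, he]; field_simp; ring
  have i2 : (1 - w₀) + θ = 2 * e := by rw [hw₀, hθ, he]; field_simp; ring
  have i3 : (1 + (s - 3)⁻¹) * (1 - e) = 1 / 3 := by
    rw [he]
    have e1 : 1 + (s - 3)⁻¹ = (s - 2) / (s - 3) := by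
      rw [inv_eq_one_div, one_add_div hs3]; ring
    rw [e1]
    field_simp
    ring
  -- the constant
  obtain ⟨K₀, hK₀⟩ : ∃ K : ℝ, K = Cp * C₆ ^ (w₀ / 6) * CT ^ ((1 - w₀) / 6) := ⟨_, rfl⟩
  rw [← hK₀]
  have hK₀0 : 0 ≤ K₀ := by rw [hK₀]; positivity
  obtain ⟨M, hM⟩ : ∃ M : ℝ, M = Z * U ^ (1 + (s - 3)⁻¹) := ⟨_, rfl⟩
  rw [← hM]
  have hM0 : 0 ≤ M := by rw [hM]; exact mul_nonneg hZ (Real.rpow_nonneg hU _)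
  -- step 1: `B^{1/3} ≤ C₆^{w₀/3} CT^{(1-w₀)/3} Z^w₀ I^{1-w₀}`
  have s1 : B ^ (1 / 3 : ℝ) ≤ C₆ ^ (w₀ / 3) * CT ^ ((1 - w₀) / 3) * (Z ^ w₀ * I ^ (1 - w₀)) := by
    have hb : B ≤ (C₆ * Z ^ 3) ^ w₀ * (CT * I ^ 3) ^ (1 - w₀) :=
      h5.trans (mul_le_mul (Real.rpow_le_rpow hS h6 hw₀0.le) (Real.rpow_le_rpow hT h7 (by linarith))
        (Real.rpow_nonneg hT _) (Real.rpow_nonneg (mul_nonneg hC₆ (pow_nonneg hZ 3)) _))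
    have hb' := Real.rpow_le_rpow hB hb (by norm_num : (0 : ℝ) ≤ 1 / 3)
    have eZ : (Z ^ 3) ^ (w₀ * (1 / 3)) = Z ^ w₀ := by
      rw [← Real.rpow_natCast, ← Real.rpow_mul hZ]; congr 1; push_cast; ring
    have eI : (I ^ 3) ^ ((1 - w₀) * (1 / 3)) = I ^ (1 - w₀) := by
      rw [← Real.rpow_natCast, ← Real.rpow_mul hI]; congr 1; push_cast; ring
    rw [Real.mul_rpow (Real.rpow_nonneg (mul_nonneg hC₆ (pow_nonneg hZ 3)) _)
        (Real.rpow_nonneg (mul_nonneg hCT (pow_nonneg hI 3)) _),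
      ← Real.rpow_mul (mul_nonneg hC₆ (pow_nonneg hZ 3)),
      ← Real.rpow_mul (mul_nonneg hCT (pow_nonneg hI 3)),
      Real.mul_rpow hC₆ (pow_nonneg hZ 3), Real.mul_rpow hCT (pow_nonneg hI 3), eZ, eI,
      show w₀ * (1 / 3) = w₀ / 3 by ring, show (1 - w₀) * (1 / 3) = (1 - w₀) / 3 by ring] at hb'
    calc B ^ (1 / 3 : ℝ) ≤ C₆ ^ (w₀ / 3) * Z ^ w₀ * (CT ^ ((1 - w₀) / 3) * I ^ (1 - w₀)) := hb'
      _ = C₆ ^ (w₀ / 3) * CT ^ ((1 - w₀) / 3) * (Z ^ w₀ * I ^ (1 - w₀)) := by ring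
  -- step 2: `X² ≤ K₀² U^{2/3} Z^{2(1-e)} I^{2e}`
  have s2 : X ^ 2 ≤ K₀ ^ 2 * (U ^ (2 / 3 : ℝ) * Z ^ (2 * (1 - e)) * I ^ (2 * e)) := by
    have hZw₀ : Z ^ w₀ * Z ^ (1 - θ) = Z ^ (2 * (1 - e)) := by
      rw [← Real.rpow_add' hZ (by rw [i1]; nlinarith), i1]
    have hIw₀ : I ^ (1 - w₀) * I ^ θ = I ^ (2 * e) := by
      rw [← Real.rpow_add' hI (by rw [i2]; nlinarith), i2]
    have hK2 : K₀ ^ 2 = Cp ^ 2 * (C₆ ^ (w₀ / 3) * CT ^ ((1 - w₀) / 3)) := by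
      have e1 : (C₆ ^ (w₀ / 6)) ^ 2 = C₆ ^ (w₀ / 3) := by
        rw [← Real.rpow_natCast, ← Real.rpow_mul hC₆]; congr 1; push_cast; ring
      have e2 : (CT ^ ((1 - w₀) / 6)) ^ 2 = CT ^ ((1 - w₀) / 3) := by
        rw [← Real.rpow_natCast, ← Real.rpow_mul hCT]; congr 1; push_cast; ring
      rw [hK₀, mul_pow, mul_pow, e1, e2]; ring
    calc X ^ 2 ≤ A * P := h1
      _ ≤ (U ^ (2 / 3 : ℝ) * B ^ (1 / 3 : ℝ)) * (Cp ^ 2 * J) :=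
          mul_le_mul h4 h2 hP (mul_nonneg (Real.rpow_nonneg hU _) (Real.rpow_nonneg hB _))
      _ ≤ (U ^ (2 / 3 : ℝ) * (C₆ ^ (w₀ / 3) * CT ^ ((1 - w₀) / 3) * (Z ^ w₀ * I ^ (1 - w₀)))) *
            (Cp ^ 2 * (I ^ θ * Z ^ (1 - θ))) := by
          gcongr
      _ = Cp ^ 2 * (C₆ ^ (w₀ / 3) * CT ^ ((1 - w₀) / 3)) *
            (U ^ (2 / 3 : ℝ) * (Z ^ w₀ * Z ^ (1 - θ)) * (I ^ (1 - w₀) * I ^ θ)) := by ring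
      _ = K₀ ^ 2 * (U ^ (2 / 3 : ℝ) * Z ^ (2 * (1 - e)) * I ^ (2 * e)) := by rw [hZw₀, hIw₀, hK2]
  -- step 3: the right-hand side is `(K₀ I^e M^{1-e})²`
  have s3 : K₀ ^ 2 * (U ^ (2 / 3 : ℝ) * Z ^ (2 * (1 - e)) * I ^ (2 * e)) =
      (K₀ * I ^ e * M ^ (1 - e)) ^ 2 := by
    have eM : M ^ (1 - e) = Z ^ (1 - e) * U ^ (1 / 3 : ℝ) := by
      rw [hM, Real.mul_rpow hZ (Real.rpow_nonneg hU _), ← Real.rpow_mul hU, i3]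
    have eI2 : (I ^ e) ^ 2 = I ^ (2 * e) := by
      rw [← Real.rpow_natCast, ← Real.rpow_mul hI]; congr 1; push_cast; ring
    have eZ2 : (Z ^ (1 - e)) ^ 2 = Z ^ (2 * (1 - e)) := by
      rw [← Real.rpow_natCast, ← Real.rpow_mul hZ]; congr 1; push_cast; ring
    have eU2 : (U ^ (1 / 3 : ℝ)) ^ 2 = U ^ (2 / 3 : ℝ) := by
      rw [← Real.rpow_natCast, ← Real.rpow_mul hU]; norm_num
    rw [eM]
    calc K₀ ^ 2 * (U ^ (2 / 3 : ℝ) * Z ^ (2 * (1 - e)) * I ^ (2 * e))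
        = K₀ ^ 2 * ((U ^ (1 / 3 : ℝ)) ^ 2 * (Z ^ (1 - e)) ^ 2 * (I ^ e) ^ 2) := by
          rw [eI2, eZ2, eU2]
      _ = (K₀ * I ^ e * (Z ^ (1 - e) * U ^ (1 / 3 : ℝ))) ^ 2 := by ring
  have hR0 : 0 ≤ K₀ * I ^ e * M ^ (1 - e) :=
    mul_nonneg (mul_nonneg hK₀0 (Real.rpow_nonneg hI _)) (Real.rpow_nonneg hM0 _)
  exact abs_le_of_sq_le_sq (by rw [← s3]; exact s2) hR0

end VelocityMoment

end Summit.NavierStokesRegularity.FunctionalMining
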